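import Mathlib
import Summits.Ventures.PercRepro2.SPNormalForm2

/-! # The enumeration of normal forms
(seat mine-b, cell pub-perc-repro2; MINE-B.md §26.7)

`SP.combos pool fuel n low` lists the non-decreasing (`SP.le`) lists of pool elements, all `≥ low`, whose
sizes sum to `n`; `SP.enumUpTo m` lists every normal free-edge term with at most `m` free edges, level
by level (a level = the free edge, the series and the parallel compositions of ≥ 2 smaller normal
factors of the other kind).  **`SP.mem_enumUpTo`**: every normal free-edge term with ≤ `m` edges is in
the list — so (UH*) for all free-edge terms with ≤ `m` edges is the finite statement
`∀ u ∈ SP.enumUpTo m, Universal u.rLab u.bLab` (`SP.universal_of_enumUpTo`). -/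

namespace Summit.Ventures.PercRepro2.V2Closure

open Summit.Ventures.PercRepro2.UHClosure

/-- decidable equality of terms, through the injective code -/
instance SP.instDecidableEq : DecidableEq SP := fun s t =>
  decidable_of_iff (s.toNat = t.toNat) ⟨fun h => SP.toNat_injective h, fun h => h ▸ rfl⟩

/-- non-decreasing lists of pool elements with codes `≥ lowc` and sizes summing to `n`, the pool given
as groups by size (`groups.getD k []` = the entries (term, code) of size `k`); `fuel ≥ n` suffices -/
def SP.combos (groups : List (List (SP × ℕ))) : ℕ → ℕ → ℕ → List (List SP)
  | 0, n, _ => if n = 0 then [[]] else []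
  | fuel + 1, n, lowc =>
    if n = 0 then [[]] else
      (List.range (n + 1)).flatMap fun k =>
        if k = 0 then [] else
          (groups.getD k []).flatMap fun e =>
            if lowc ≤ e.2 then (SP.combos groups fuel (n - k) e.2).map (e.1 :: ·) else []

/-- **completeness of `combos`**: a non-decreasing list of pool elements with codes `≥ lowc` and positive
sizes summing to `n ≤ fuel` is listed -/
theorem SP.mem_combos (groups : List (List (SP × ℕ))) (size : SP → ℕ) :
    ∀ (l : List SP) (fuel n lowc : ℕ), l.Pairwise SP.le' → (∀ x ∈ l, (x, x.toNat) ∈ groups.getD (size x) []) →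
      (∀ x ∈ l, 0 < size x) → (∀ x ∈ l, lowc ≤ x.toNat) → (l.map size).sum = n → n ≤ fuel →
      l ∈ SP.combos groups fuel n lowc := by
  intro l
  induction l with
  | nil =>
    intro fuel n lowc _ _ _ _ hsum _
    simp only [List.map_nil, List.sum_nil] at hsum
    subst hsum
    cases fuel <;> simp [SP.combos]
  | cons x l ih =>
    intro fuel n lowc hsorted hpool hpos hlow hsum hfuel
    simp only [List.map_cons, List.sum_cons] at hsum
    have hx : 0 < size x := hpos x (List.mem_cons_self ..)
    obtain ⟨f, rfl⟩ : ∃ f, fuel = f + 1 := ⟨fuel - 1, by omega⟩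
    have hn : n ≠ 0 := by omega
    simp only [SP.combos, hn, if_false, List.mem_flatMap, List.mem_range]
    refine ⟨size x, by omega, ?_⟩
    have hk : size x ≠ 0 := by omega
    simp only [hk, if_false, List.mem_flatMap]
    refine ⟨(x, x.toNat), hpool x (List.mem_cons_self ..), ?_⟩
    have hcond : lowc ≤ x.toNat := hlow x (List.mem_cons_self ..)
    simp only [hcond, if_true, List.mem_map]
    refine ⟨l, ?_, rfl⟩
    apply ih f (n - size x) x.toNat
    · exact hsorted.of_cons
    · exact fun y hy => hpool y (List.mem_cons_of_mem x hy)
    · exact fun y hy => hpos y (List.mem_cons_of_mem x hy)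
    · intro y hy
      have := List.rel_of_pairwise_cons hsorted hy
      simp only [SP.le', SP.le, decide_eq_true_eq] at this
      exact this
    · omega
    · omega

/-- the pool of a level, grouped by size: group `k` = the listed terms of the other kind with `k` free
edges, with their codes -/
def SP.groupsOf (prev : List SP) (p : SP → Bool) (m : ℕ) : List (List (SP × ℕ)) :=
  (List.range (m + 1)).map fun k =>
    (prev.filter fun x => p x = false ∧ x.nfree = k).map fun x => (x, x.toNat)

/-- membership in a group -/
theorem SP.mem_groupsOf {prev : List SP} {p : SP → Bool} {m : ℕ} {x : SP} (hx : x ∈ prev)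
    (hp : p x = false) (hk : x.nfree ≤ m) : (x, x.toNat) ∈ (SP.groupsOf prev p m).getD x.nfree [] := by
  unfold SP.groupsOf
  rw [List.getD_eq_getElem?_getD, List.getElem?_map, List.getElem?_range (by omega)]
  simp only [Option.map_some, Option.getD_some, List.mem_map, List.mem_filter]
  exact ⟨x, ⟨hx, by simp [hp]⟩, rfl⟩

/-- the compositions of ≥ 2 factors from a list of factor lists -/
def SP.compsOf (ls : List (List SP)) (mk : SP → List SP → SP) : List SP :=
  ls.filterMap fun l => match l with
    | a :: b :: l' => some (mk a (b :: l'))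
    | _ => none

/-- **all normal free-edge terms with at most `m` free edges**, level by level -/
def SP.enumUpTo : ℕ → List SP
  | 0 => []
  | m + 1 =>
    let prev := SP.enumUpTo m
    prev ++ ((if m = 0 then [SP.free] else []) ++
      SP.compsOf (SP.combos (SP.groupsOf prev SP.isSer m) (m + 1) (m + 1) 0) SP.serL ++
      SP.compsOf (SP.combos (SP.groupsOf prev SP.isPar m) (m + 1) (m + 1) 0) SP.parL)

/-- the enumeration grows with the bound -/
theorem SP.enumUpTo_mono {m m' : ℕ} (h : m ≤ m') : SP.enumUpTo m ⊆ SP.enumUpTo m' := by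
  induction h with
  | refl => exact fun _ hx => hx
  | step _ ih => exact fun x hx => List.mem_append_left _ (ih hx)

/-- the free edge is listed from level `1` on -/
theorem SP.free_mem_enumUpTo {m : ℕ} (h : 1 ≤ m) : SP.free ∈ SP.enumUpTo m := by
  apply SP.enumUpTo_mono h
  simp [SP.enumUpTo]

/-- `free` is the least term for `SP.le` -/
theorem SP.le_free (x : SP) : SP.le SP.free x = true := by
  simp [SP.le, SP.toNat]

/-- the number of free edges of a left-nested series composition -/
theorem SP.nfree_serL (a : SP) (l : List SP) : (SP.serL a l).nfree = a.nfree + (l.map SP.nfree).sum := by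
  induction l generalizing a with
  | nil => simp [SP.serL]
  | cons b l ih => rw [SP.serL_cons, ih]; simp [SP.nfree, Nat.add_assoc]

/-- the number of free edges of a left-nested parallel composition -/
theorem SP.nfree_parL (a : SP) (l : List SP) : (SP.parL a l).nfree = a.nfree + (l.map SP.nfree).sum := by
  induction l generalizing a with
  | nil => simp [SP.parL]
  | cons b l ih => rw [SP.parL_cons, ih]; simp [SP.nfree, Nat.add_assoc]

/-- the factors of a free-edge series composition are free-edge terms -/
theorem SP.isFree_of_serL {a : SP} {l : List SP} (h : (SP.serL a l).IsFree) : ∀ x ∈ a :: l, x.IsFree := by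
  induction l generalizing a with
  | nil => intro x hx; simp at hx; subst hx; exact h
  | cons b l ih =>
    rw [SP.serL_cons] at h
    have := ih h
    intro x hx
    rcases List.mem_cons.1 hx with rfl | hx
    · exact (this (SP.ser x b) (List.mem_cons_self ..)).1
    · rcases List.mem_cons.1 hx with rfl | hx
      · exact (this (SP.ser a x) (List.mem_cons_self ..)).2
      · exact this x (List.mem_cons_of_mem _ hx)

/-- the factors of a free-edge parallel composition are free-edge terms -/
theorem SP.isFree_of_parL {a : SP} {l : List SP} (h : (SP.parL a l).IsFree) : ∀ x ∈ a :: l, x.IsFree := by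
  induction l generalizing a with
  | nil => intro x hx; simp at hx; subst hx; exact h
  | cons b l ih =>
    rw [SP.parL_cons] at h
    have := ih h
    intro x hx
    rcases List.mem_cons.1 hx with rfl | hx
    · exact (this (SP.par x b) (List.mem_cons_self ..)).1
    · rcases List.mem_cons.1 hx with rfl | hx
      · exact (this (SP.par a x) (List.mem_cons_self ..)).2
      · exact this x (List.mem_cons_of_mem _ hx)

/-- a free-edge term has at least one free edge -/
theorem SP.nfree_pos (s : SP) (h : s.IsFree) : 0 < s.nfree := by
  induction s with
  | free => exact Nat.one_pos
  | pin => exact h.elim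
  | absent => exact h.elim
  | ser s t ihs _ => exact Nat.add_pos_left (ihs h.1) _
  | par s t ihs _ => exact Nat.add_pos_left (ihs h.1) _
/-- in a list of ≥ 2 positive sizes, every size is at most the total minus one -/
theorem SP.size_le_sum_sub_one (size : SP → ℕ) (a b : SP) (l : List SP)
    (hpos : ∀ x ∈ a :: b :: l, 0 < size x) :
    ∀ x ∈ a :: b :: l, size x + 1 ≤ ((a :: b :: l).map size).sum := by
  intro x hx
  simp only [List.map_cons, List.sum_cons]
  rcases List.mem_cons.1 hx with rfl | hx
  · have := hpos b (List.mem_cons_of_mem _ (List.mem_cons_self ..)); omega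
  · have h1 := hpos a (List.mem_cons_self ..)
    have h2 : size x ≤ ((b :: l).map size).sum :=
      List.le_sum_of_mem (List.mem_map.2 ⟨x, hx, rfl⟩)
    simp only [List.map_cons, List.sum_cons] at h2
    omega

/-- the series compositions of a combination list are listed by `compsOf` -/
theorem SP.mem_compsOf {ls : List (List SP)} {a b : SP} {l : List SP} (h : a :: b :: l ∈ ls)
    (mk : SP → List SP → SP) : mk a (b :: l) ∈ SP.compsOf ls mk :=
  List.mem_filterMap.2 ⟨a :: b :: l, h, rfl⟩

/-- **completeness of the enumeration**: every normal free-edge term with at most `m` free edges is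
listed in `SP.enumUpTo m` -/
theorem SP.mem_enumUpTo {u : SP} (hu : SP.IsNF u) : ∀ m, u.IsFree → u.nfree ≤ m → u ∈ SP.enumUpTo m := by
  induction hu with
  | free => intro m _ hm; exact SP.free_mem_enumUpTo hm
  | ser a l hl hs hn hk ih =>
    intro m hfree hm
    obtain ⟨b, l', rfl⟩ := List.exists_cons_of_ne_nil hl
    have hfactors := SP.isFree_of_serL hfree
    have hpos : ∀ x ∈ a :: b :: l', 0 < x.nfree := fun x hx => SP.nfree_pos x (hfactors x hx)
    have hsum := SP.nfree_serL a (b :: l')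
    have hbound := SP.size_le_sum_sub_one SP.nfree a b l' hpos
    obtain ⟨n', hn'⟩ : ∃ n', (SP.serL a (b :: l')).nfree = n' + 1 := by
      have := hbound a (List.mem_cons_self ..)
      simp only [List.map_cons, List.sum_cons] at this hsum
      exact ⟨(SP.serL a (b :: l')).nfree - 1, by omega⟩
    apply SP.enumUpTo_mono (show n' + 1 ≤ m by omega)
    have hprev : ∀ x ∈ a :: b :: l', x ∈ SP.enumUpTo n' := by
      intro x hx
      apply ih x hx n' (hfactors x hx)
      have h1 := hbound x hx
      simp only [List.map_cons, List.sum_cons] at h1 hsum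
      omega
    have hcomb : a :: b :: l' ∈ SP.combos (SP.groupsOf (SP.enumUpTo n') SP.isSer n') (n' + 1) (n' + 1) 0 := by
      apply SP.mem_combos _ SP.nfree _ _ _ _ hs
      · intro x hx
        apply SP.mem_groupsOf (hprev x hx) (hk x hx)
        have h1 := hbound x hx
        simp only [List.map_cons, List.sum_cons] at h1 hsum
        omega
      · exact hpos
      · intro x _; exact Nat.zero_le _
      · simp only [List.map_cons, List.sum_cons] at hsum ⊢; omega
      · exact le_refl _
    show SP.serL a (b :: l') ∈ SP.enumUpTo n' ++ _
    apply List.mem_append_right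
    apply List.mem_append_left
    apply List.mem_append_right
    exact SP.mem_compsOf hcomb SP.serL
  | par a l hl hs hn hk ih =>
    intro m hfree hm
    obtain ⟨b, l', rfl⟩ := List.exists_cons_of_ne_nil hl
    have hfactors := SP.isFree_of_parL hfree
    have hpos : ∀ x ∈ a :: b :: l', 0 < x.nfree := fun x hx => SP.nfree_pos x (hfactors x hx)
    have hsum := SP.nfree_parL a (b :: l')
    have hbound := SP.size_le_sum_sub_one SP.nfree a b l' hpos
    obtain ⟨n', hn'⟩ : ∃ n', (SP.parL a (b :: l')).nfree = n' + 1 := by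
      have := hbound a (List.mem_cons_self ..)
      simp only [List.map_cons, List.sum_cons] at this hsum
      exact ⟨(SP.parL a (b :: l')).nfree - 1, by omega⟩
    apply SP.enumUpTo_mono (show n' + 1 ≤ m by omega)
    have hprev : ∀ x ∈ a :: b :: l', x ∈ SP.enumUpTo n' := by
      intro x hx
      apply ih x hx n' (hfactors x hx)
      have h1 := hbound x hx
      simp only [List.map_cons, List.sum_cons] at h1 hsum
      omega
    have hcomb : a :: b :: l' ∈ SP.combos (SP.groupsOf (SP.enumUpTo n') SP.isPar n') (n' + 1) (n' + 1) 0 := by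
      apply SP.mem_combos _ SP.nfree _ _ _ _ hs
      · intro x hx
        apply SP.mem_groupsOf (hprev x hx) (hk x hx)
        have h1 := hbound x hx
        simp only [List.map_cons, List.sum_cons] at h1 hsum
        omega
      · exact hpos
      · intro x _; exact Nat.zero_le _
      · simp only [List.map_cons, List.sum_cons] at hsum ⊢; omega
      · exact le_refl _
    show SP.parL a (b :: l') ∈ SP.enumUpTo n' ++ _
    apply List.mem_append_right
    apply List.mem_append_right
    exact SP.mem_compsOf hcomb SP.parL

/-- **(UH*) for every free-edge term with at most `m` edges, from the finite list** -/
theorem SP.universal_of_enumUpTo (m : ℕ) (hall : ∀ u ∈ SP.enumUpTo m, Universal u.rLab u.bLab)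
    (s : SP) (hs : s.IsFree) (hm : s.nfree ≤ m) : Universal s.rLab s.bLab :=
  SP.universal_of_nf s (hall s.nf (SP.mem_enumUpTo (SP.isNF_nf s hs) m (SP.isFree_nf s hs)
    (by rw [SP.nfree_nf]; exact hm)))


end Summit.Ventures.PercRepro2.V2Closure
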